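import Summits.Ventures.QEC.Census.HB.HB90b.BZStructZ
import Summits.Ventures.QEC.Census.HB.HB90b.BZBoundsZ
import Summits.Ventures.QEC.Census.HB.HB90b.BZInfoSetsZ1
import Summits.Ventures.QEC.Census.HB.HB90b.BZEnumZ01
import Summits.Ventures.QEC.Census.HB.HB90b.BZEnumZ02
import Summits.Ventures.QEC.Census.HB.HB90b.BZEnumZ03
import Summits.Ventures.QEC.Census.HB.HB90b.BZEnumZ04
import Summits.Ventures.QEC.Census.CertCheckBZSound
import Summits.Ventures.QEC.Census.CertChunks
import HarnessLib

/-!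
# `HB90b` — `bz` certificate, side Z: ASSEMBLY `d_Z = 8` (tier KERNEL (CERTIFIED); emitted by qec-search-7)

`(cert.code _).dZ = 8` for the CSS code of the certificate (`Fin 90`, check matrices `rowMatrix 90 cert.HX/HZ`) by
type-10's `DistCert.dZ_code_of_bz` (`Census/CertCheckBZSound.lean`: structural check of the distance certificate +
`bzZStruct` + `bzZLen` + every block) with each block recombined from its KERNEL information-set facts
(`BZInfoSetsZ*`), its enumeration verdicts (`BZEnumZ*`) and its bound (`BZBoundsZ`) by
`CertBZInfoSets.bzZBlock_of_parts`.
-/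

namespace Summit.Ventures.QEC.Census.HB90b

/-- Block 0 of side Z passes type-10's block check (from its parts). -/
theorem blkZ_0 : HB90b.cert.bzZBlock HB90b.bzData 0 = true :=
  cert.bzZBlock_of_parts bzData (b := 0) (blk := bzBlockZ0) rfl rfl
    (forall_lt_append (forall_lt_append (forall_lt_zero) (forall_lt_single 0 sysZ_0_0)) (forall_lt_single 1 sysZ_0_1))
    (forall_lt_append (forall_lt_append (forall_lt_zero) (forall_lt_single 0 enumZ_0_0)) (forall_lt_single 1 enumZ_0_1))
    boundZ_0

/-- Block 1 of side Z passes type-10's block check (from its parts). -/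
theorem blkZ_1 : HB90b.cert.bzZBlock HB90b.bzData 1 = true :=
  cert.bzZBlock_of_parts bzData (b := 1) (blk := bzBlockZ1) rfl rfl
    (forall_lt_append (forall_lt_append (forall_lt_zero) (forall_lt_single 0 sysZ_1_0)) (forall_lt_single 1 sysZ_1_1))
    (forall_lt_append (forall_lt_append (forall_lt_zero) (forall_lt_single 0 enumZ_1_0)) (forall_lt_single 1 enumZ_1_1))
    boundZ_1

/-- Block 2 of side Z passes type-10's block check (from its parts). -/
theorem blkZ_2 : HB90b.cert.bzZBlock HB90b.bzData 2 = true :=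
  cert.bzZBlock_of_parts bzData (b := 2) (blk := bzBlockZ2) rfl rfl
    (forall_lt_append (forall_lt_append (forall_lt_zero) (forall_lt_single 0 sysZ_2_0)) (forall_lt_single 1 sysZ_2_1))
    (forall_lt_append (forall_lt_append (forall_lt_zero) (forall_lt_single 0 enumZ_2_0)) (forall_lt_single 1 enumZ_2_1))
    boundZ_2

/-- Block 3 of side Z passes type-10's block check (from its parts). -/
theorem blkZ_3 : HB90b.cert.bzZBlock HB90b.bzData 3 = true :=
  cert.bzZBlock_of_parts bzData (b := 3) (blk := bzBlockZ3) rfl rfl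
    (forall_lt_append (forall_lt_append (forall_lt_zero) (forall_lt_single 0 sysZ_3_0)) (forall_lt_single 1 sysZ_3_1))
    (forall_lt_append (forall_lt_append (forall_lt_zero) (forall_lt_single 0 enumZ_3_0)) (forall_lt_single 1 enumZ_3_1))
    boundZ_3

/-- Block 4 of side Z passes type-10's block check (from its parts). -/
theorem blkZ_4 : HB90b.cert.bzZBlock HB90b.bzData 4 = true :=
  cert.bzZBlock_of_parts bzData (b := 4) (blk := bzBlockZ4) rfl rfl
    (forall_lt_append (forall_lt_append (forall_lt_zero) (forall_lt_single 0 sysZ_4_0)) (forall_lt_single 1 sysZ_4_1))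
    (forall_lt_append (forall_lt_append (forall_lt_zero) (forall_lt_single 0 enumZ_4_0)) (forall_lt_single 1 enumZ_4_1))
    boundZ_4

/-- Block 5 of side Z passes type-10's block check (from its parts). -/
theorem blkZ_5 : HB90b.cert.bzZBlock HB90b.bzData 5 = true :=
  cert.bzZBlock_of_parts bzData (b := 5) (blk := bzBlockZ5) rfl rfl
    (forall_lt_append (forall_lt_append (forall_lt_zero) (forall_lt_single 0 sysZ_5_0)) (forall_lt_single 1 sysZ_5_1))
    (forall_lt_append (forall_lt_append (forall_lt_zero) (forall_lt_single 0 enumZ_5_0)) (forall_lt_single 1 enumZ_5_1))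
    boundZ_5

/-- Block 6 of side Z passes type-10's block check (from its parts). -/
theorem blkZ_6 : HB90b.cert.bzZBlock HB90b.bzData 6 = true :=
  cert.bzZBlock_of_parts bzData (b := 6) (blk := bzBlockZ6) rfl rfl
    (forall_lt_append (forall_lt_append (forall_lt_zero) (forall_lt_single 0 sysZ_6_0)) (forall_lt_single 1 sysZ_6_1))
    (forall_lt_append (forall_lt_append (forall_lt_zero) (forall_lt_single 0 enumZ_6_0)) (forall_lt_single 1 enumZ_6_1))
    boundZ_6

/-- Block 7 of side Z passes type-10's block check (from its parts). -/
theorem blkZ_7 : HB90b.cert.bzZBlock HB90b.bzData 7 = true :=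
  cert.bzZBlock_of_parts bzData (b := 7) (blk := bzBlockZ7) rfl rfl
    (forall_lt_append (forall_lt_append (forall_lt_zero) (forall_lt_single 0 sysZ_7_0)) (forall_lt_single 1 sysZ_7_1))
    (forall_lt_append (forall_lt_append (forall_lt_zero) (forall_lt_single 0 enumZ_7_0)) (forall_lt_single 1 enumZ_7_1))
    boundZ_7

/-- Block 8 of side Z passes type-10's block check (from its parts). -/
theorem blkZ_8 : HB90b.cert.bzZBlock HB90b.bzData 8 = true :=
  cert.bzZBlock_of_parts bzData (b := 8) (blk := bzBlockZ8) rfl rfl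
    (forall_lt_append (forall_lt_append (forall_lt_zero) (forall_lt_single 0 sysZ_8_0)) (forall_lt_single 1 sysZ_8_1))
    (forall_lt_append (forall_lt_append (forall_lt_zero) (forall_lt_single 0 enumZ_8_0)) (forall_lt_single 1 enumZ_8_1))
    boundZ_8

/-- Block 9 of side Z passes type-10's block check (from its parts). -/
theorem blkZ_9 : HB90b.cert.bzZBlock HB90b.bzData 9 = true :=
  cert.bzZBlock_of_parts bzData (b := 9) (blk := bzBlockZ9) rfl rfl
    (forall_lt_append (forall_lt_append (forall_lt_zero) (forall_lt_single 0 sysZ_9_0)) (forall_lt_single 1 sysZ_9_1))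
    (forall_lt_append (forall_lt_append (forall_lt_zero) (forall_lt_single 0 enumZ_9_0)) (forall_lt_single 1 enumZ_9_1))
    boundZ_9

/-- Block 10 of side Z passes type-10's block check (from its parts). -/
theorem blkZ_10 : HB90b.cert.bzZBlock HB90b.bzData 10 = true :=
  cert.bzZBlock_of_parts bzData (b := 10) (blk := bzBlockZ10) rfl rfl
    (forall_lt_append (forall_lt_append (forall_lt_zero) (forall_lt_single 0 sysZ_10_0)) (forall_lt_single 1 sysZ_10_1))
    (forall_lt_append (forall_lt_append (forall_lt_zero) (forall_lt_single 0 enumZ_10_0)) (forall_lt_single 1 enumZ_10_1))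
    boundZ_10

/-- Block 11 of side Z passes type-10's block check (from its parts). -/
theorem blkZ_11 : HB90b.cert.bzZBlock HB90b.bzData 11 = true :=
  cert.bzZBlock_of_parts bzData (b := 11) (blk := bzBlockZ11) rfl rfl
    (forall_lt_append (forall_lt_append (forall_lt_zero) (forall_lt_single 0 sysZ_11_0)) (forall_lt_single 1 sysZ_11_1))
    (forall_lt_append (forall_lt_append (forall_lt_zero) (forall_lt_single 0 enumZ_11_0)) (forall_lt_single 1 enumZ_11_1))
    boundZ_11

/-- Block 12 of side Z passes type-10's block check (from its parts). -/
theorem blkZ_12 : HB90b.cert.bzZBlock HB90b.bzData 12 = true :=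
  cert.bzZBlock_of_parts bzData (b := 12) (blk := bzBlockZ12) rfl rfl
    (forall_lt_append (forall_lt_append (forall_lt_zero) (forall_lt_single 0 sysZ_12_0)) (forall_lt_single 1 sysZ_12_1))
    (forall_lt_append (forall_lt_append (forall_lt_zero) (forall_lt_single 0 enumZ_12_0)) (forall_lt_single 1 enumZ_12_1))
    boundZ_12

/-- Block 13 of side Z passes type-10's block check (from its parts). -/
theorem blkZ_13 : HB90b.cert.bzZBlock HB90b.bzData 13 = true :=
  cert.bzZBlock_of_parts bzData (b := 13) (blk := bzBlockZ13) rfl rfl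
    (forall_lt_append (forall_lt_append (forall_lt_zero) (forall_lt_single 0 sysZ_13_0)) (forall_lt_single 1 sysZ_13_1))
    (forall_lt_append (forall_lt_append (forall_lt_zero) (forall_lt_single 0 enumZ_13_0)) (forall_lt_single 1 enumZ_13_1))
    boundZ_13

/-- Block 14 of side Z passes type-10's block check (from its parts). -/
theorem blkZ_14 : HB90b.cert.bzZBlock HB90b.bzData 14 = true :=
  cert.bzZBlock_of_parts bzData (b := 14) (blk := bzBlockZ14) rfl rfl
    (forall_lt_append (forall_lt_append (forall_lt_zero) (forall_lt_single 0 sysZ_14_0)) (forall_lt_single 1 sysZ_14_1))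
    (forall_lt_append (forall_lt_append (forall_lt_zero) (forall_lt_single 0 enumZ_14_0)) (forall_lt_single 1 enumZ_14_1))
    boundZ_14

/-- Block 15 of side Z passes type-10's block check (from its parts). -/
theorem blkZ_15 : HB90b.cert.bzZBlock HB90b.bzData 15 = true :=
  cert.bzZBlock_of_parts bzData (b := 15) (blk := bzBlockZ15) rfl rfl
    (forall_lt_append (forall_lt_append (forall_lt_zero) (forall_lt_single 0 sysZ_15_0)) (forall_lt_single 1 sysZ_15_1))
    (forall_lt_append (forall_lt_append (forall_lt_zero) (forall_lt_single 0 enumZ_15_0)) (forall_lt_single 1 enumZ_15_1))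
    boundZ_15

/-- Block 16 of side Z passes type-10's block check (from its parts). -/
theorem blkZ_16 : HB90b.cert.bzZBlock HB90b.bzData 16 = true :=
  cert.bzZBlock_of_parts bzData (b := 16) (blk := bzBlockZ16) rfl rfl
    (forall_lt_append (forall_lt_append (forall_lt_zero) (forall_lt_single 0 sysZ_16_0)) (forall_lt_single 1 sysZ_16_1))
    (forall_lt_append (forall_lt_append (forall_lt_zero) (forall_lt_single 0 enumZ_16_0)) (forall_lt_single 1 enumZ_16_1))
    boundZ_16

set_option maxRecDepth 100000 in
/-- **`d_Z = 8` for `HB90b`** (tier KERNEL (CERTIFIED)): the CSS code of the certificate has Z-distance exactly 8. -/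
theorem dZ_eq_bz : (HB90b.cert.code (HB90b.cert.commOK_of_checkStructure (by decide +kernel))).dZ = 8 :=
  HB90b.cert.dZ_code_of_bz HB90b.bzData (by decide +kernel) bzZStruct_ok bzZLen_ok
    (forall_lt_append (forall_lt_append (forall_lt_append (forall_lt_append (forall_lt_append (forall_lt_append (forall_lt_append (forall_lt_append (forall_lt_append (forall_lt_append (forall_lt_append (forall_lt_append (forall_lt_append (forall_lt_append (forall_lt_append (forall_lt_append (forall_lt_append (forall_lt_zero) (forall_lt_single 0 blkZ_0)) (forall_lt_single 1 blkZ_1)) (forall_lt_single 2 blkZ_2)) (forall_lt_single 3 blkZ_3)) (forall_lt_single 4 blkZ_4)) (forall_lt_single 5 blkZ_5)) (forall_lt_single 6 blkZ_6)) (forall_lt_single 7 blkZ_7)) (forall_lt_single 8 blkZ_8)) (forall_lt_single 9 blkZ_9)) (forall_lt_single 10 blkZ_10)) (forall_lt_single 11 blkZ_11)) (forall_lt_single 12 blkZ_12)) (forall_lt_single 13 blkZ_13)) (forall_lt_single 14 blkZ_14)) (forall_lt_single 15 blkZ_15)) (forall_lt_single 16 blkZ_16))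

end Summit.Ventures.QEC.Census.HB90b
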